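import Mathlib
import Summits.RiemannHypothesis.RiemannHypothesis.Theorems.WeilFormatCDeflatedFar
import HarnessLib

/-!
# Format C, design C∞: the deflated certificate with LIMIT (infinite-range) profile data

Route context: Fourier–Galerkin / Schur-complement certificates of Weil positivity on a window ("format C";
cell memo `run/shared/lean/pub/rh-explicit/rh-explicit-weil-10/FORMATC-DESIGN.md` §9.12.9; supporting
stmt-RiemannHypothesis-0098; seat rh-explicit-weil-10).

`sum_range_mul_mul_nonneg_of_certificate_deflated` (the finite core) takes profiles supported on `[B, P)`.  The lever of
design C∞ needs INFINITE-range profiles (the window polynomials), whose augmented Gram, coupling majorant and rank-`r`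
correction are closed-form LIMITS of the finite-`P` objects.  This file is the abstract wrapper that makes the limit data
usable WITHOUT any function-space formulation: if the kernel inequality holds for the limit objects with a strict margin
`δ·(|x|² + |β|²)` and the finite-`P` objects approximate the limit objects to within `ε·(|x|² + |β|²)` for every `ε > 0` at
SOME `P` (any rate — the `P` is never materialised), then positivity follows (take `ε = δ/3` and the finite theorem at that `P`).

* `sum_range_mul_mul_nonneg_of_certificate_deflated_limit`.

Pure finite-dimensional real algebra; standard axioms; nothing Weil-specific; no RH claim.
-/

-- `Summit.RiemannHypothesis.RiemannHypothesis.…` is the layout-mandated namespace (summit = problem name).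
set_option linter.dupNamespace false

namespace Summit.RiemannHypothesis.RiemannHypothesis.Theorems.WeilFormatC

open Matrix Finset

/-- **Deflated certificate with limit data.**  `Kq`, `Uq`, `Cq` are the limit augmented Gram form, coupling majorant and
rank-`r` correction as abstract functions of `(x, β)` (the data side encloses them by closed forms); `hS` is the limit kernel
inequality with margin `δ`; `happrox` says that for every `ε > 0` some finite profile table `V` on some `[B, P)` reproduces the
three objects to within `ε·(Σx² + Σβ²)` (with the finite-`P` expressions written exactly as in the finite theorem, `Λ` fixed). -/
theorem sum_range_mul_mul_nonneg_of_certificate_deflated_limit (M : ℕ → ℕ → ℝ) (hsymm : ∀ n m, M n m = M m n)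
    (B : ℕ) {r : ℕ} (dhat : ℕ → ℝ) (hd : ∀ m, B ≤ m → 0 < dhat m)
    (hfar : ∀ (N : ℕ) (y : ℕ → ℝ),
      ∑ n ∈ Ico B N, dhat n * y n ^ 2 ≤ ∑ n ∈ Ico B N, ∑ m ∈ Ico B N, y n * M n m * y m)
    (Λ : (Fin B → ℝ) → (Fin r → ℝ) → Fin r → ℝ)
    (Kq Uq Cq : (Fin B → ℝ) → (Fin r → ℝ) → ℝ) {δ : ℝ} (hδ : 0 < δ)
    (hS : ∀ (x : Fin B → ℝ) (β : Fin r → ℝ),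
      δ * (∑ i, x i ^ 2 + ∑ j, β j ^ 2) ≤ Kq x β - Uq x β + Cq x β)
    (happrox : ∀ ε : ℝ, 0 < ε → ∃ P : ℕ, B ≤ P ∧ ∃ V : ℕ → Fin r → ℝ,
      (∀ (x : Fin B → ℝ) (β : Fin r → ℝ),
        |((∑ i : Fin B, ∑ i' : Fin B, x i * x i' * M i i')
          + 2 * (∑ i : Fin B, ∑ j : Fin r, x i * β j * ∑ m ∈ Ico B P, M i m * V m j)
          + (∑ j : Fin r, ∑ j' : Fin r, β j * β j' * ∑ n ∈ Ico B P, ∑ m ∈ Ico B P, V n j * M n m * V m j'))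
          - Kq x β| ≤ ε * (∑ i, x i ^ 2 + ∑ j, β j ^ 2)) ∧
      (∀ (N : ℕ) (x : Fin B → ℝ) (β : Fin r → ℝ),
        ∑ m ∈ Ico B N, (∑ i : Fin B, M i m * x i + ∑ n ∈ Ico B P, M n m * ∑ j, V n j * β j) ^ 2 / dhat m
          ≤ Uq x β + ε * (∑ i, x i ^ 2 + ∑ j, β j ^ 2)) ∧
      (∀ (x : Fin B → ℝ) (β : Fin r → ℝ),
        |(2 * ∑ j : Fin r, Λ x β j *
            ((β j - ∑ j' : Fin r, (∑ n ∈ Ico B P, V n j * V n j') * β j')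
              + ∑ m ∈ Ico B P, V m j * (∑ i : Fin B, M i m * x i + ∑ n ∈ Ico B P, M n m * ∑ j, V n j * β j) / dhat m)
          - ∑ j : Fin r, ∑ j' : Fin r, Λ x β j * Λ x β j' * ∑ m ∈ Ico B P, V m j * V m j' / dhat m)
          - Cq x β| ≤ ε * (∑ i, x i ^ 2 + ∑ j, β j ^ 2)))
    (N : ℕ) (y : ℕ → ℝ) :
    0 ≤ ∑ n ∈ range N, ∑ m ∈ range N, y n * y m * M n m := by
  obtain ⟨P, hBP, V, hK, hU, hC⟩ := happrox (δ / 3) (by positivity)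
  refine sum_range_mul_mul_nonneg_of_certificate_deflated M hsymm B P hBP V dhat hd hfar
    (fun x β ↦ Uq x β + δ / 3 * (∑ i, x i ^ 2 + ∑ j, β j ^ 2)) Λ hU ?_ N y
  intro x β
  have h1 := hK x β
  have h2 := hC x β
  have h3 := hS x β
  have hs : 0 ≤ ∑ i, x i ^ 2 + ∑ j, β j ^ 2 := by positivity
  rw [abs_le] at h1 h2
  nlinarith [h1.1, h1.2, h2.1, h2.2, h3, hs]

end Summit.RiemannHypothesis.RiemannHypothesis.Theorems.WeilFormatC
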